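import Summits.ResolutionOfSingularities.ResolutionOfSingularities.Theorems.FrobeniusLadderFInjectiveMacaulayficationStrictTransformNonClosed
import Summits.ResolutionOfSingularities.ResolutionOfSingularities.Theorems.FrobeniusLadderFInjectiveMacaulayficationBadPointsClosed
import Summits.ResolutionOfSingularities.ResolutionOfSingularities.Theorems.FrobeniusLadderFInjectiveMacaulayficationFiLocusOpenOfAffine
import Literature.AlgebraicGeometry.Resolution.AlterationsNormalFormBlowupFormal
import Mathlib.RingTheory.Ideal.KrullsHeightTheorem
import Mathlib.AlgebraicGeometry.FunctionField
import HarnessLib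

/-!
# THE ADJACENCY MECHANISM (kernel form): a centre supported AT `b` ALONE along a bad stratum `B` never cures `b`
# (crux `FInjectiveMacaulayfication` stmt-ResolutionOfSingularities-15315, chain w45a; res-L1-w45a-tri-2 22:00:53Z suggestion «state the mechanism once, generally»,
# over the scheme half p575659 `…StrictTransformNonClosed`; seat res-L1-w45a-stub-2)

[OURS · L1 W4.5a] Support file (`--supports stmt-ResolutionOfSingularities-15315 --as helper`); NOT a statement of any manuscript; def-free, unconditional;
AI-written (AI review is weaker than expert review).

`exists_nonClosed_not_cmfi_over`: `π : X₂ → X₁` a blowing up along `J` (`X₁` locally Noetherian); `i : B → X₁` a closed immersion, `B` integral,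
Noetherian, with integrally closed local rings; `b ∈ B` with `dim 𝒪_{B,b} ≥ 2`, `i(b) ∈ supp J` but `i(y) ∉ supp J` for every other `y ∈ B`; all stalks
of `X₂` of characteristic `p`; the F-clause FAILS at `𝒪_{X₁, i(η_B)}`. THEN some NON-closed `ζ ∈ X₂` over `i(b)` fails «CM clause ∧ F-clause» (hence
is not FULL). PROOF: `J·𝒪_{B,b}` is `𝔪`-primary (a prime over it is a generization of `b` inside `supp (J·𝒪_B) = {b}`,
`fromSpecStalk_mem_support_iff`), so were it principal, Krull's principal ideal theorem (Mathlib `Ideal.height_le_one_of_isPrincipal_of_mem_minimalPrimes`)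
would give `dim 𝒪_{B,b} ≤ 1`; hence `StrictTransformNonClosed.exists_nonClosed_specializes` yields `η′ ⤳ ζ` over `η_B ⤳ b` with `ζ` non-closed; CM ∧ F at
`ζ` would pass to the generization `η′` (`BadPointsClosed.clause_of_specializes` — CMFI localizes, in the tree) and along `𝒪_{X₂,η′} ≅ 𝒪_{X₁,i(η_B)}`
(`π` is an isomorphism off `supp J`), contradicting the hypothesis. [cite: StacksProject, Tag 00KV] [cite: GortzWedhorn2020, Prop. 13.91]
-/

-- single-problem summit: the doubled namespace component is forced
set_option linter.dupNamespace false

noncomputable section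

namespace Summit.ResolutionOfSingularities.ResolutionOfSingularities.Theorems.FInjectiveMacaulayfication.StrictTransformAdjacency

open CategoryTheory AlgebraicGeometry TopologicalSpace IsLocalRing
open Literature.AlgebraicGeometry.Resolution
open Summit.ResolutionOfSingularities.ResolutionOfSingularities.Theorems.FInjectiveMacaulayfication

/-- **An `𝔪`-primary ideal of a Noetherian local ring of dimension `≥ 2` is not principal** (Krull's principal ideal theorem): here «`𝔪`-primary» is
phrased as «every prime containing `I` is `𝔪`». [cite: StacksProject, Tag 00KV] -/
theorem not_principal_of_forall_prime_eq_maximalIdeal {A : Type} [CommRing A] [IsNoetherianRing A] [IsLocalRing A] (I : Ideal A)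
    (hI : I ≤ maximalIdeal A) (hprimes : ∀ 𝔮 : Ideal A, 𝔮.IsPrime → I ≤ 𝔮 → 𝔮 = maximalIdeal A)
    (hdim : (2 : WithBot ℕ∞) ≤ ringKrullDim A) : ¬ ∃ g : A, I = Ideal.span {g} := by
  rintro ⟨g, rfl⟩
  have hmin : maximalIdeal A ∈ (Ideal.span {g}).minimalPrimes :=
    ⟨⟨(maximalIdeal.isMaximal A).isPrime, hI⟩, fun 𝔮 h𝔮 _ => (hprimes 𝔮 h𝔮.1 h𝔮.2).symm.le⟩
  have hht : (maximalIdeal A).height ≤ 1 := Ideal.height_le_one_of_isPrincipal_of_mem_minimalPrimes (Ideal.span {g}) _ hmin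
  rw [← IsLocalRing.maximalIdeal_height_eq_ringKrullDim] at hdim
  have h2 : (2 : ℕ∞) ≤ (maximalIdeal A).height := WithBot.coe_le_coe.mp (by simpa only [WithBot.coe_ofNat] using hdim)
  have h21 : (2 : ℕ∞) ≤ 1 := h2.trans hht
  exact absurd h21 (by decide)

/-- **THE ADJACENCY MECHANISM.** See the module docstring. [OURS · folklore plumbing] [cite: StacksProject, Tag 00KV] [cite: GortzWedhorn2020, Prop. 13.91] -/
theorem exists_nonClosed_not_cmfi_over {X₁ X₂ B : Scheme.{0}} {J : X₁.IdealSheafData} {π : X₂ ⟶ X₁} (hπ : IsBlowup π J)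
    [IsLocallyNoetherian X₁] (i : B ⟶ X₁) [IsClosedImmersion i] [IsIntegral B] [IsNoetherian B]
    (hnorm : ∀ y : B, IsIntegrallyClosed (B.presheaf.stalk y)) (b : B) (hdim : (2 : WithBot ℕ∞) ≤ ringKrullDim (B.presheaf.stalk b))
    (hJb : i.base b ∈ (J.support : Set X₁)) (hJoff : ∀ y : B, y ≠ b → i.base y ∉ (J.support : Set X₁))
    (p : ℕ) [Fact p.Prime] (hchar : ∀ x : X₂, CharP (X₂.presheaf.stalk x) p)
    (hbad : ¬ ∀ d : ℕ, ringKrullDim (X₁.presheaf.stalk (i.base (genericPoint B))) = d →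
      ∀ s : Fin d → X₁.presheaf.stalk (i.base (genericPoint B)), (Ideal.span (Set.range s)).radical.IsMaximal →
        ∀ z : X₁.presheaf.stalk (i.base (genericPoint B)), (∃ e : ℕ, z ^ p ^ e ∈ Ideal.span
          ((fun w : X₁.presheaf.stalk (i.base (genericPoint B)) => w ^ p ^ e) ''
            (Ideal.span (Set.range s) : Set (X₁.presheaf.stalk (i.base (genericPoint B)))))) → z ∈ Ideal.span (Set.range s)) :
    ∃ ζ : X₂, π.base ζ = i.base b ∧ ¬ IsClosed ({ζ} : Set X₂) ∧
      ¬ ((∀ d : ℕ, ringKrullDim (X₂.presheaf.stalk ζ) = d → ∀ s : Fin d → X₂.presheaf.stalk ζ,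
            (Ideal.span (Set.range s)).radical.IsMaximal → RingTheory.Sequence.IsWeaklyRegular (X₂.presheaf.stalk ζ) (List.ofFn s)) ∧
        (∀ d : ℕ, ringKrullDim (X₂.presheaf.stalk ζ) = d → ∀ s : Fin d → X₂.presheaf.stalk ζ,
            (Ideal.span (Set.range s)).radical.IsMaximal → ∀ z : X₂.presheaf.stalk ζ, (∃ e : ℕ, z ^ p ^ e ∈ Ideal.span
              ((fun w : X₂.presheaf.stalk ζ => w ^ p ^ e) '' (Ideal.span (Set.range s) : Set (X₂.presheaf.stalk ζ)))) →
              z ∈ Ideal.span (Set.range s))) := by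
  classical
  set I : B.IdealSheafData := J.comap i with hIdef
  have hsupp : ∀ y : B, y ∈ (I.support : Set B) ↔ i.base y ∈ (J.support : Set X₁) := fun y => by
    rw [hIdef, Scheme.IdealSheafData.support_comap]; rfl
  -- `b` is not the generic point of `B` (its local ring has dimension ≥ 2)
  have hbgen : genericPoint B ≠ b := by
    intro h
    subst h
    have hF : IsField (B.presheaf.stalk (genericPoint B)) := (Field.toIsField B.functionField)
    have h0 : ringKrullDim (B.presheaf.stalk (genericPoint B)) = 0 := ringKrullDim_eq_zero_of_isField hF
    rw [h0] at hdim
    exact absurd hdim (by decide)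
  -- `I = J·𝒪_B ≠ ⊥`
  have hI : I ≠ ⊥ := by
    intro h
    have hmem : genericPoint B ∈ (I.support : Set B) := by rw [h, Scheme.IdealSheafData.support_bot]; trivial
    exact hJoff _ hbgen ((hsupp _).mp hmem)
  -- `I_b` is `𝔪`-primary, hence not principal (dim ≥ 2)
  have hIb : stalkIdeal I b ≤ maximalIdeal _ := (mem_support_iff_stalkIdeal_le I b).mp ((hsupp b).mpr hJb)
  have hprimes : ∀ 𝔮 : Ideal (B.presheaf.stalk b), 𝔮.IsPrime → stalkIdeal I b ≤ 𝔮 → 𝔮 = maximalIdeal _ := by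
    intro 𝔮 h𝔮 hle
    have hy : B.fromSpecStalk b ⟨𝔮, h𝔮⟩ ∈ (I.support : Set B) := (fromSpecStalk_mem_support_iff b I ⟨𝔮, h𝔮⟩).mpr hle
    have hyb : B.fromSpecStalk b ⟨𝔮, h𝔮⟩ = b := by
      by_contra hne
      exact hJoff _ hne ((hsupp _).mp hy)
    have hinj : Function.Injective (B.fromSpecStalk b).base := (B.fromSpecStalk b).isEmbedding.injective
    have hpt : (⟨𝔮, h𝔮⟩ : PrimeSpectrum (B.presheaf.stalk b)) = closedPoint (B.presheaf.stalk b) :=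
      hinj (hyb.trans (Scheme.fromSpecStalk_closedPoint (x := b)).symm)
    exact congrArg PrimeSpectrum.asIdeal hpt
  have hnotprinc : ¬ ∃ g, stalkIdeal I b = Ideal.span {g} :=
    not_principal_of_forall_prime_eq_maximalIdeal _ hIb hprimes hdim
  -- the non-closed point over `b` and the point over the generic point of `B`
  obtain ⟨η', ζ, hη', hζ, hspec, hζcl⟩ := StrictTransformNonClosed.exists_nonClosed_specializes hπ i hnorm hI b hnotprinc
  refine ⟨ζ, hζ, hζcl, fun hcl => hbad ?_⟩
  -- CM ∧ F at `ζ` passes to the generization `η′` …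
  haveI : IsProper π := hπ.isProper
  haveI : IsLocallyNoetherian X₂ := LocallyOfFiniteType.isLocallyNoetherian π
  haveI := hchar ζ
  have hmerged : ∀ d : ℕ, ringKrullDim (X₂.presheaf.stalk ζ) = d → ∀ s : Fin d → X₂.presheaf.stalk ζ,
      (Ideal.span (Set.range s)).radical.IsMaximal → RingTheory.Sequence.IsWeaklyRegular (X₂.presheaf.stalk ζ) (List.ofFn s) ∧
        ∀ z : X₂.presheaf.stalk ζ, (∃ e : ℕ, z ^ p ^ e ∈ Ideal.span
          ((fun w : X₂.presheaf.stalk ζ => w ^ p ^ e) '' (Ideal.span (Set.range s) : Set (X₂.presheaf.stalk ζ)))) →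
            z ∈ Ideal.span (Set.range s) :=
    fun d hd s hs => ⟨hcl.1 d hd s hs, hcl.2 d hd s hs⟩
  have hη'cl := BadPointsClosed.clause_of_specializes p hspec hmerged
  -- … and along `𝒪_{X₂,η′} ≅ 𝒪_{X₁, i(η_B)}` (`π` is an isomorphism off `supp J`)
  have hηJ : π.base η' ∉ (J.support : Set X₁) := by rw [hη']; exact hJoff _ hbgen
  haveI : IsIso (π ∣_ ⟨(J.support : Set X₁)ᶜ, J.support.isClosed.isOpen_compl⟩) := hπ.isIso_compl
  haveI : IsIso (π.stalkMap η') :=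
    RegularBlowupModelDim2.isIso_stalkMap_of_isIso_morphismRestrict π ⟨(J.support : Set X₁)ᶜ, J.support.isClosed.isOpen_compl⟩ η' hηJ
  obtain ⟨e⟩ : Nonempty (X₂.presheaf.stalk η' ≃+* X₁.presheaf.stalk (i.base (genericPoint B))) := by
    rw [← hη']
    exact ⟨(asIso (π.stalkMap η')).commRingCatIsoToRingEquiv.symm⟩
  exact FiLocusOpenOfAffine.fClause_of_ringEquiv p e fun d hd s hs => (hη'cl d hd s hs).2

end Summit.ResolutionOfSingularities.ResolutionOfSingularities.Theorems.FInjectiveMacaulayfication.StrictTransformAdjacency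

end
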